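import Literature.AlgebraicGeometry.RealAlgebraic.RealAlgebraicCoordinates
import Literature.AlgebraicGeometry.Motives.GAGAKaehlerImmersionProofs
import HarnessLib

/-!
# Veronese-type algebraic coordinates on the real points of a projective scheme

Let `k` be a field and `ι : X ⟶ ℙⁿ_k` a closed immersion of `k`-schemes. Writing `x₀, …, xₙ` for
the homogeneous coordinates and `t_{j,c} = ι^*(x_c/x_j) ∈ Γ(X, U_j)`, `U_j = ι⁻¹D₊(x_j)`, for the
affine coordinates of the standard charts (the generating-sections datum
`GeneratingSections.affineChartData ι` of the tree, Hartshorne II Thm. 7.1 (a)), this file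
constructs the **Veronese coordinates**

  `y_{ab} = x_a x_b / (x₀² + ⋯ + xₙ²) ∈ Γ(X, V)`,  `V = X ∖ {Σ_c x_c² = 0} = ⋃_j X_{g_j}`,
  `g_j = Σ_c t_{j,c}² ∈ Γ(X, U_j)`,

by gluing the local functions `t_{j,a} t_{j,b} / g_j` on the basic opens `W_j = X_{g_j} ⊆ U_j`
(sheaf gluing, the pieces agreeing by the cocycle rule `t_{l,c} = t_{l,j} t_{j,c}`), and proves
that they form an **algebraic coordinate system on the `L`-points of `X` for every ordered field
`L ⊇ k`** (`Literature.AlgebraicGeometry.RealAlgebraic.IsAlgCoordSystem`, file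
`RealAlgebraic/RealAlgebraicCoordinates`): `isAlgCoordSystem_veronese`.

* every `L`-point lies in some `U_j`, where `g_j ≥ t_{j,j}² = 1 > 0`, hence in `W_j ⊆ V`
  (`pt_mem_veroneseOpen`);
* the charts are the `W_j`, affine as basic opens of the affine `U_j` (`ι` is affine), with
  denominator `b = y_{jj}`: on `L`-points `y_{jj}(Q) = t_{l,j}(Q)²/g_l(Q) ≠ 0 ↔ Q ∈ U_j ↔ Q ∈ W_j`;
  `y_{jj}|_{W_j} = g_j⁻¹` is a unit; and every `s ∈ Γ(X, W_j)` is `a(y)/y_{jj}^M`: `s = a'/g_j^m`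
  with `a' ∈ Γ(X, U_j)` (`W_j` is a basic open of the affine `U_j`), `a'` is a polynomial in the
  `t_{j,c}` with coefficients in `k` since `ι` is a closed immersion (Hartshorne II Prop. 7.2, the
  tree's `GeneratingSections.exists_eq_eval₂_homRatio`), and `t_{j,c} = y_{jc} g_j`,
  `g_j = y_{jj}⁻¹` on `W_j`, the power of `y_{jj}⁻¹` being cleared by
  `exists_clear_denominator`.

This is the scheme-theoretic form of the classical affine embedding of real projective varieties:
`[x] ↦ (x_a x_b/|x|²)_{a,b}` identifies `ℝPⁿ` with the symmetric idempotent matrices of rank one,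
an algebraic subset of `ℝ^{(n+1)²}`, and every projective real algebraic set with an affine one
(Akbulut–King, *Topology of Real Algebraic Sets*, II §4, Prop. 2.4.1 and Cor. 2.4.2;
Bochnak–Coste–Roy, *Real Algebraic Geometry*, Thm. 3.4.4 and its proof). Combined with
`RealAlgebraic/RealAlgebraicCoordinates` and `RealAlgebraic/RealAlgebraicSubmanifold` it yields,
for a smooth projective `X` over a real-algebraic field `k ⊆ ℝ`, a closed embedding of `X(ℝ)` onto
a compact `ℚ`-semialgebraic `C^∞` submanifold of `ℝ^{(n+1)²}` whose coordinates are regular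
functions — the data of `RealAbelJacobi.Realization` for `C(ℝ)` and `J(ℝ)`
(`RealAbelJacobi.exists_realization`). No named fact is introduced.

## References

* S. Akbulut, H. King, *Topology of Real Algebraic Sets*, MSRI Publ. 25 (1992), Ch. II §4,
  Prop. 2.4.1, Cor. 2.4.2. [AkbulutKing1992]
* J. Bochnak, M. Coste, M.-F. Roy, *Real Algebraic Geometry* (1998), Thm. 3.4.4.
  [BochnakCosteRoy1998]
* R. Hartshorne, *Algebraic Geometry* (1977), II Thm. 7.1 (a), II Prop. 7.2. [Hartshorne1977]
-/

universe u

noncomputable section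

open CategoryTheory AlgebraicGeometry TopologicalSpace Opposite
open MvPolynomial (C aeval eval₂ rename bind₁)
open _root_.Topology

attribute [local instance] MvPolynomial.gradedAlgebra

namespace Literature.AlgebraicGeometry.RealAlgebraic

open Literature.AlgebraicGeometry.Motives Literature.AlgebraicGeometry.Motives.GeneratingSections
  Literature.AlgebraicGeometry.Motives.Segre Literature.NumberTheory.Transcendental

/-! ### Clearing one inverted variable -/

section ClearDenominator

variable {k R : Type*} [CommRing k] [CommRing R] (φ : k →+* R) {N : ℕ}

/-- **Clearing an inverted variable.** For every polynomial `A ∈ k[y₁, …, y_N, u]` there are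
`a ∈ k[y₁, …, y_N]` and `M ∈ ℕ` such that `A(y, u) · y_{j₀}^M = a(y)` whenever `u y_{j₀} = 1`
(write `A = Σ_e A_e(y) uᵉ` and take `M ≥ max e`). [folklore] -/
theorem exists_clear_denominator (j₀ : Fin N) (A : MvPolynomial (Fin (N + 1)) k) :
    ∃ (a : MvPolynomial (Fin N) k) (M : ℕ), ∀ (y : Fin N → R) (u : R), u * y j₀ = 1 →
      eval₂ φ (Fin.snoc y u) A * y j₀ ^ M = eval₂ φ y a := by
  induction A using MvPolynomial.induction_on with
  | C c => exact ⟨C c, 0, fun y u _ => by simp⟩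
  | add p q hp hq =>
    obtain ⟨ap, Mp, hap⟩ := hp
    obtain ⟨aq, Mq, haq⟩ := hq
    refine ⟨ap * MvPolynomial.X j₀ ^ Mq + aq * MvPolynomial.X j₀ ^ Mp, Mp + Mq, fun y u hu => ?_⟩
    rw [MvPolynomial.eval₂_add, add_mul, MvPolynomial.eval₂_add, MvPolynomial.eval₂_mul,
      MvPolynomial.eval₂_mul, MvPolynomial.eval₂_pow, MvPolynomial.eval₂_pow,
      MvPolynomial.eval₂_X, ← hap y u hu, ← haq y u hu, pow_add]
    ring
  | mul_X p i hp =>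
    obtain ⟨ap, Mp, hap⟩ := hp
    refine Fin.lastCases ?_ (fun c => ?_) i
    · refine ⟨ap, Mp + 1, fun y u hu => ?_⟩
      rw [MvPolynomial.eval₂_mul, MvPolynomial.eval₂_X, Fin.snoc_last, ← hap y u hu, pow_succ]
      calc eval₂ φ (Fin.snoc y u) p * u * (y j₀ ^ Mp * y j₀)
          = eval₂ φ (Fin.snoc y u) p * y j₀ ^ Mp * (u * y j₀) := by ring
        _ = eval₂ φ (Fin.snoc y u) p * y j₀ ^ Mp := by rw [hu, mul_one]
    · refine ⟨ap * MvPolynomial.X c, Mp, fun y u hu => ?_⟩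
      rw [MvPolynomial.eval₂_mul, MvPolynomial.eval₂_X, Fin.snoc_castSucc, MvPolynomial.eval₂_mul,
        MvPolynomial.eval₂_X, ← hap y u hu]
      ring

end ClearDenominator

/-! ### Complements on `pullbackPoly`: substitution is a ring homomorphism, scalars, pull-backs -/

section PullbackPolyAlgebra

variable {k : Type u} [Field k] {X Y : SchemeOver k} {N : ℕ}

/-- Restricting the scalar `c ∈ k` from `U` to `W ⊆ U` gives the scalar `c` on `W`. [folklore] -/
theorem rs_scalarRingHom {U W : X.left.Opens} (h : W ≤ U) (c : k) :
    rs h (SchemeOver.scalarRingHom X U c) = SchemeOver.scalarRingHom X W c := by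
  rw [SchemeOver.scalarRingHom_apply, SchemeOver.scalarRingHom_apply]
  change (X.hom.appLE ⊤ U le_top ≫ X.left.presheaf.map (homOfLE h).op)
    ((Scheme.ΓSpecIso (.of k)).inv c) = _
  rw [Scheme.Hom.appLE_map]

/-- **Scalars pull back to scalars** along a `k`-morphism `φ : X → Y`: `φ^*(c|_V) = c|_U` for
`U ⊆ φ⁻¹V` (both come from `Γ(Spec k, 𝒪) = k`, and `X → Spec k` factors through `φ`).
[folklore] -/
theorem appLE_scalarRingHom (φ : X ⟶ Y) {V : Y.left.Opens} {U : X.left.Opens}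
    (hle : U ≤ φ.left ⁻¹ᵁ V) (c : k) :
    φ.left.appLE V U hle (SchemeOver.scalarRingHom Y V c) = SchemeOver.scalarRingHom X U c := by
  rw [SchemeOver.scalarRingHom_apply, SchemeOver.scalarRingHom_apply]
  have h1 : φ.left.appLE V U hle (Y.hom.appLE ⊤ V le_top ((Scheme.ΓSpecIso (.of k)).inv c)) =
      (Y.hom.appLE ⊤ V le_top ≫ φ.left.appLE V U hle) ((Scheme.ΓSpecIso (.of k)).inv c) := rfl
  rw [h1, Scheme.Hom.appLE_comp_appLE]
  have key : ∀ (g : X.left ⟶ Spec (.of k)) (_ : g = X.hom) (e' : U ≤ g ⁻¹ᵁ ⊤),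
      g.appLE ⊤ U e' = X.hom.appLE ⊤ U le_top := by
    rintro _ rfl _
    rfl
  rw [key _ (Over.w φ)]

variable {V W : X.left.Opens} (hWV : W ≤ V) (f : Fin N → Γ(X.left, V))

/-- Substituting the restricted coordinates into the variable `y_m` gives `f_m|_W`. [folklore] -/
theorem pullbackPoly_X (m : Fin N) : pullbackPoly hWV f (MvPolynomial.X m) = rs hWV (f m) :=
  MvPolynomial.eval₂_X _ _ _

/-- Substituting into a constant gives the scalar. [folklore] -/
theorem pullbackPoly_C (c : k) : pullbackPoly hWV f (C c) = SchemeOver.scalarRingHom X W c :=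
  MvPolynomial.eval₂_C _ _ _

/-- Substitution is additive. [folklore] -/
theorem pullbackPoly_add (a b : MvPolynomial (Fin N) k) :
    pullbackPoly hWV f (a + b) = pullbackPoly hWV f a + pullbackPoly hWV f b :=
  MvPolynomial.eval₂_add _ _

/-- Substitution is multiplicative. [folklore] -/
theorem pullbackPoly_mul (a b : MvPolynomial (Fin N) k) :
    pullbackPoly hWV f (a * b) = pullbackPoly hWV f a * pullbackPoly hWV f b :=
  MvPolynomial.eval₂_mul _ _

/-- Substitution commutes with powers. [folklore] -/
theorem pullbackPoly_pow (a : MvPolynomial (Fin N) k) (n : ℕ) :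
    pullbackPoly hWV f (a ^ n) = pullbackPoly hWV f a ^ n :=
  map_pow (MvPolynomial.eval₂Hom (SchemeOver.scalarRingHom X W)
    (fun j => X.left.presheaf.map (homOfLE hWV).op (f j))) a n

/-- Substitution commutes with restriction to a smaller open. [folklore] -/
theorem rs_pullbackPoly {W' : X.left.Opens} (h : W' ≤ W) (a : MvPolynomial (Fin N) k) :
    rs h (pullbackPoly hWV f a) = pullbackPoly (h.trans hWV) f a := by
  unfold pullbackPoly
  rw [MvPolynomial.eval₂_comp_left (rs h)]
  congr 1
  · exact RingHom.ext fun c => rs_scalarRingHom h c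
  · funext j
    exact rs_rs hWV h (f j)

/-- **Substitution commutes with pull-back along a `k`-morphism** `φ : X → Y`: for coordinates
`f_j ∈ Γ(Y, V)`, `W ⊆ V` and `U ⊆ φ⁻¹W`,
`φ^*(a(f₁|_W, …, f_N|_W)) = a(φ^*f₁|_U, …, φ^*f_N|_U)`. [folklore] -/
theorem appLE_pullbackPoly (φ : X ⟶ Y) {V W : Y.left.Opens} (hWV : W ≤ V)
    (f : Fin N → Γ(Y.left, V)) {U : X.left.Opens} (hle : U ≤ φ.left ⁻¹ᵁ W)
    (a : MvPolynomial (Fin N) k) :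
    φ.left.appLE W U hle (pullbackPoly hWV f a) =
      MvPolynomial.eval₂ (SchemeOver.scalarRingHom X U)
        (fun j => φ.left.appLE V U (hle.trans (φ.left.preimage_mono hWV)) (f j)) a := by
  unfold pullbackPoly
  rw [MvPolynomial.eval₂_comp_left (φ.left.appLE W U hle).hom]
  congr 1
  · exact RingHom.ext fun c => appLE_scalarRingHom φ hle c
  · funext j
    change (Y.left.presheaf.map (homOfLE hWV).op ≫ φ.left.appLE W U hle) (f j) = _
    rw [Scheme.Hom.map_appLE]

end PullbackPolyAlgebra

/-! ### The Veronese coordinates of a closed subscheme of `ℙⁿ_k` -/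

section Construction

variable {k : Type} [Field k] {X : SchemeOver k} {n : ℕ} (ι : X ⟶ projectiveSpace n k)

/-- The denominator `g_j = Σ_c t_{j,c}² = (Σ_c x_c²)/x_j² ∈ Γ(X, U_j)` on the `j`-th affine chart
`U_j = ι⁻¹D₊(x_j)`. [cite: AkbulutKing1992, Ch. II §4, Prop. 2.4.1] -/
def veroneseDen (j : Fin (n + 1)) : Γ(X.left, (affineChartData ι).U j) :=
  ∑ c, (affineChartData ι).ratio j c ^ 2

/-- The Veronese chart `W_j = X_{g_j} ⊆ U_j`, where `Σ_c x_c² ≠ 0` inside `D₊(x_j)`.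
[cite: AkbulutKing1992, Ch. II §4, Prop. 2.4.1] -/
abbrev veroneseChart (j : Fin (n + 1)) : X.left.Opens :=
  X.left.basicOpen (veroneseDen ι j)

/-- `W_j ≤ U_j`. [folklore] -/
theorem veroneseChart_le (j : Fin (n + 1)) : veroneseChart ι j ≤ (affineChartData ι).U j :=
  X.left.basicOpen_le _

/-- The open `V = ⋃_j W_j = X ∖ {Σ_c x_c² = 0}` carrying the Veronese coordinates.
[cite: AkbulutKing1992, Ch. II §4, Prop. 2.4.1] -/
def veroneseOpen : X.left.Opens :=
  ⨆ j, veroneseChart ι j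

/-- `W_j ≤ V`. [folklore] -/
theorem veroneseChart_le_veroneseOpen (j : Fin (n + 1)) : veroneseChart ι j ≤ veroneseOpen ι :=
  le_iSup (veroneseChart ι) j

/-- `g_j` restricted to `W_j` is a unit. [folklore] -/
theorem isUnit_rs_veroneseDen (j : Fin (n + 1)) :
    IsUnit (rs (veroneseChart_le ι j) (veroneseDen ι j)) :=
  isUnit_rs_basicOpen _

/-- The local Veronese coordinate `y_{ab}|_{W_j} = t_{j,a} t_{j,b} · g_j⁻¹ ∈ Γ(X, W_j)`.
[cite: AkbulutKing1992, Ch. II §4, Prop. 2.4.1] -/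
def veroneseLocal (j a b : Fin (n + 1)) : Γ(X.left, veroneseChart ι j) :=
  rs (veroneseChart_le ι j) ((affineChartData ι).ratio j a * (affineChartData ι).ratio j b) *
    ↑(isUnit_rs_veroneseDen ι j).unit⁻¹

/-- The defining equation of the local coordinate: `y_{ab}|_{W_j} · g_j = t_{j,a} t_{j,b}`.
[folklore] -/
theorem veroneseLocal_mul_den (j a b : Fin (n + 1)) :
    veroneseLocal ι j a b * rs (veroneseChart_le ι j) (veroneseDen ι j) =
      rs (veroneseChart_le ι j) ((affineChartData ι).ratio j a * (affineChartData ι).ratio j b) := by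
  rw [veroneseLocal, mul_assoc, IsUnit.val_inv_mul, mul_one]

/-- On `U_l ∩ U_j`: `g_l = t_{l,j}² g_j` (cocycle rule `t_{l,c} = t_{l,j} t_{j,c}`). [folklore] -/
theorem rs_veroneseDen_eq (j l : Fin (n + 1)) :
    rs ((affineChartData ι).V_le_left l j) (veroneseDen ι l) =
      rs ((affineChartData ι).V_le_left l j) ((affineChartData ι).ratio l j) ^ 2 *
        rs ((affineChartData ι).V_le_right l j) (veroneseDen ι j) := by
  simp only [veroneseDen, map_sum, map_pow, Finset.mul_sum]
  refine Finset.sum_congr rfl fun c _ => ?_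
  rw [← (affineChartData ι).cocycle l j c, mul_pow]

/-- **The local Veronese coordinates agree on overlaps**: `y_{ab}|_{W_j} = y_{ab}|_{W_l}` on
`W_j ∩ W_l` (both equal `t_{l,a}t_{l,b}/g_l = t_{l,j}² t_{j,a}t_{j,b} / (t_{l,j}² g_j)`).
[folklore] -/
theorem veroneseLocal_compat (a b j l : Fin (n + 1)) :
    rs (inf_le_left : veroneseChart ι j ⊓ veroneseChart ι l ≤ veroneseChart ι j)
        (veroneseLocal ι j a b) =
      rs (inf_le_right : veroneseChart ι j ⊓ veroneseChart ι l ≤ veroneseChart ι l)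
        (veroneseLocal ι l a b) := by
  set D := affineChartData ι
  set O : X.left.Opens := veroneseChart ι j ⊓ veroneseChart ι l with hO
  have hOj : O ≤ veroneseChart ι j := inf_le_left
  have hOl : O ≤ veroneseChart ι l := inf_le_right
  have hOV : O ≤ D.V l j := by
    rw [D.V_eq]
    exact le_inf (hOl.trans (veroneseChart_le ι l)) (hOj.trans (veroneseChart_le ι j))
  -- the players, restricted to `O`
  set x := rs hOj (veroneseLocal ι j a b) with hx
  set x' := rs hOl (veroneseLocal ι l a b) with hx'
  set Gj := rs (hOj.trans (veroneseChart_le ι j)) (veroneseDen ι j) with hGj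
  set Gl := rs (hOl.trans (veroneseChart_le ι l)) (veroneseDen ι l) with hGl
  set t := rs (hOV.trans (D.V_le_left l j)) (D.ratio l j) with ht
  have hGj_unit : IsUnit Gj := by
    have := (isUnit_rs_veroneseDen ι j).map (rs hOj)
    rwa [rs_rs] at this
  have ht_unit : IsUnit t := by
    have := (D.isUnit_ratio_left l j).map (rs hOV)
    rwa [rs_rs] at this
  -- `x Gj = t_{ja} t_{jb}`, `x' Gl = t_{la} t_{lb}`
  have ex : x * Gj = rs (hOj.trans (veroneseChart_le ι j)) (D.ratio j a * D.ratio j b) := by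
    have h := congrArg (rs hOj) (veroneseLocal_mul_den ι j a b)
    simpa only [map_mul, rs_rs] using h
  have ex' : x' * Gl = rs (hOl.trans (veroneseChart_le ι l)) (D.ratio l a * D.ratio l b) := by
    have h := congrArg (rs hOl) (veroneseLocal_mul_den ι l a b)
    simpa only [map_mul, rs_rs] using h
  -- `Gl = t² Gj`, `t_{la} t_{lb} = t² t_{ja} t_{jb}` on `O`
  have eG : Gl = t ^ 2 * Gj := by
    have h := congrArg (rs hOV) (rs_veroneseDen_eq ι j l)
    simpa only [map_mul, map_pow, rs_rs] using h
  have eab : rs (hOl.trans (veroneseChart_le ι l)) (D.ratio l a * D.ratio l b) =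
      t ^ 2 * rs (hOj.trans (veroneseChart_le ι j)) (D.ratio j a * D.ratio j b) := by
    have ha := congrArg (rs hOV) (D.cocycle l j a)
    have hb := congrArg (rs hOV) (D.cocycle l j b)
    simp only [map_mul, rs_rs] at ha hb
    rw [map_mul, map_mul, ← ha, ← hb]
    ring
  -- cancel the units
  have key : x' * t ^ 2 * Gj = x * t ^ 2 * Gj := by
    calc x' * t ^ 2 * Gj = x' * Gl := by rw [eG]; ring
      _ = t ^ 2 * (x * Gj) := by rw [ex', eab, ex]
      _ = x * t ^ 2 * Gj := by ring
  have h1 := (hGj_unit.mul_left_inj).mp key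
  exact ((ht_unit.pow 2).mul_left_inj.mp h1).symm

/-- **The Veronese coordinate `y_{ab} = x_a x_b/Σ_c x_c² ∈ Γ(X, V)`**, glued from the local
coordinates `t_{j,a}t_{j,b}/g_j` on the `W_j` (sheaf property of `𝒪_X`).
[cite: AkbulutKing1992, Ch. II §4, Prop. 2.4.1] -/
def veroneseCoord (a b : Fin (n + 1)) : Γ(X.left, veroneseOpen ι) :=
  (X.left.sheaf.existsUnique_gluing (veroneseChart ι) (fun j => veroneseLocal ι j a b)
    (fun j l => veroneseLocal_compat ι a b j l)).exists.choose

/-- `y_{ab}|_{W_j} = t_{j,a}t_{j,b}/g_j`. [folklore] -/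
theorem rs_veroneseCoord (j a b : Fin (n + 1)) :
    rs (veroneseChart_le_veroneseOpen ι j) (veroneseCoord ι a b) = veroneseLocal ι j a b :=
  (X.left.sheaf.existsUnique_gluing (veroneseChart ι) (fun j => veroneseLocal ι j a b)
    (fun j l => veroneseLocal_compat ι a b j l)).exists.choose_spec j

/-- The Veronese coordinates as a family indexed by `Fin ((n+1)·(n+1))` (pairs `(a, b)` through
`finProdFinEquiv`). [cite: AkbulutKing1992, Ch. II §4, Prop. 2.4.1] -/
def veroneseCoords : Fin ((n + 1) * (n + 1)) → Γ(X.left, veroneseOpen ι) :=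
  fun m => veroneseCoord ι (finProdFinEquiv.symm m).1 (finProdFinEquiv.symm m).2

/-- The index of the pair `(a, b)`. [folklore] -/
abbrev vIdx (a b : Fin (n + 1)) : Fin ((n + 1) * (n + 1)) := finProdFinEquiv (a, b)

/-- `veroneseCoords (vIdx a b) = y_{ab}`. [folklore] -/
@[simp] theorem veroneseCoords_vIdx (a b : Fin (n + 1)) :
    veroneseCoords ι (vIdx a b) = veroneseCoord ι a b := by
  simp [veroneseCoords, vIdx]

end Construction

/-! ### Values at `L`-points -/

section Points

variable {k : Type} [Field k] {X : SchemeOver k} {n : ℕ} (ι : X ⟶ projectiveSpace n k)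
  {L : Type} [Field L] [Algebra k L]

/-- The value of `g_j` at `Q ∈ U_j(L)` is `Σ_c t_{j,c}(Q)²`. [folklore] -/
theorem eval_veroneseDen (j : Fin (n + 1)) (Q : AlgPoints X L)
    (h : Q.pt ∈ (affineChartData ι).U j) :
    Q.eval _ h (veroneseDen ι j) = ∑ c, Q.eval _ h ((affineChartData ι).ratio j c) ^ 2 := by
  rw [veroneseDen, ← AlgPoints.evalRingHom_apply, map_sum]
  simp only [map_pow, AlgPoints.evalRingHom_apply]

/-- An `L`-point of `U_j` lies in `W_j` iff `Σ_c t_{j,c}(Q)² ≠ 0`. [folklore] -/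
theorem pt_mem_veroneseChart_iff (j : Fin (n + 1)) (Q : AlgPoints X L)
    (h : Q.pt ∈ (affineChartData ι).U j) :
    Q.pt ∈ veroneseChart ι j ↔ ∑ c, Q.eval _ h ((affineChartData ι).ratio j c) ^ 2 ≠ 0 := by
  rw [veroneseChart, AlgPoints.pt_mem_basicOpen_iff Q h, eval_veroneseDen]

/-- **The value of a Veronese coordinate**: for `Q ∈ W_j(L)`,
`y_{ab}(Q) = t_{j,a}(Q) t_{j,b}(Q) / Σ_c t_{j,c}(Q)²` (`= x_a x_b/Σ x_c²` in homogeneous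
coordinates). [cite: AkbulutKing1992, Ch. II §4, Prop. 2.4.1] -/
theorem eval_veroneseCoord (a b j : Fin (n + 1)) (Q : AlgPoints X L) (hW : Q.pt ∈ veroneseChart ι j)
    (hV : Q.pt ∈ veroneseOpen ι) :
    Q.eval _ hV (veroneseCoord ι a b) =
      Q.eval _ (veroneseChart_le ι j hW) ((affineChartData ι).ratio j a) *
        Q.eval _ (veroneseChart_le ι j hW) ((affineChartData ι).ratio j b) /
        ∑ c, Q.eval _ (veroneseChart_le ι j hW) ((affineChartData ι).ratio j c) ^ 2 := by
  have hU : Q.pt ∈ (affineChartData ι).U j := veroneseChart_le ι j hW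
  have hden : ∑ c, Q.eval _ hU ((affineChartData ι).ratio j c) ^ 2 ≠ 0 :=
    (pt_mem_veroneseChart_iff ι j Q hU).mp hW
  have h1 : Q.eval _ hV (veroneseCoord ι a b) = Q.eval _ hW (veroneseLocal ι j a b) := by
    rw [← rs_veroneseCoord ι j a b]
    exact (AlgPoints.eval_map_homOfLE (veroneseChart_le_veroneseOpen ι j) _ hW).symm
  have h2 := congrArg (Q.evalRingHom _ hW) (veroneseLocal_mul_den ι j a b)
  simp only [map_mul, AlgPoints.evalRingHom_apply] at h2
  rw [AlgPoints.eval_map_homOfLE (veroneseChart_le ι j) _ hW,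
    AlgPoints.eval_map_homOfLE (veroneseChart_le ι j) _ hW,
    AlgPoints.eval_map_homOfLE (veroneseChart_le ι j) _ hW, eval_veroneseDen] at h2
  rw [h1, eq_div_iff hden]
  exact h2

end Points

/-! ### Ordered fields: every `L`-point lies in `V`, and the charts `W_j` -/

section Ordered

variable {k : Type} [Field k] {X : SchemeOver k} {n : ℕ} (ι : X ⟶ projectiveSpace n k)
  {L : Type} [Field L] [LinearOrder L] [IsStrictOrderedRing L] [Algebra k L]

/-- Over an ordered field, `Σ_c t_{j,c}(Q)² ≥ t_{j,j}(Q)² = 1 > 0` at every `L`-point of `U_j`.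
[folklore] -/
theorem sum_sq_eval_ratio_pos (j : Fin (n + 1)) (Q : AlgPoints X L)
    (h : Q.pt ∈ (affineChartData ι).U j) :
    0 < ∑ c, Q.eval _ h ((affineChartData ι).ratio j c) ^ 2 := by
  have h1 : Q.eval _ h ((affineChartData ι).ratio j j) ^ 2 = 1 := by
    rw [GeneratingSections.eval_ratio_self ι j Q h, one_pow]
  calc (0 : L) < 1 := one_pos
    _ = Q.eval _ h ((affineChartData ι).ratio j j) ^ 2 := h1.symm
    _ ≤ ∑ c, Q.eval _ h ((affineChartData ι).ratio j c) ^ 2 :=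
        Finset.single_le_sum (f := fun c => Q.eval _ h ((affineChartData ι).ratio j c) ^ 2)
          (fun c _ => sq_nonneg _) (Finset.mem_univ j)

/-- Over an ordered field, an `L`-point lies in `W_j` iff it lies in `U_j`. [folklore] -/
theorem pt_mem_veroneseChart_iff_mem_U (j : Fin (n + 1)) (Q : AlgPoints X L) :
    Q.pt ∈ veroneseChart ι j ↔ Q.pt ∈ (affineChartData ι).U j := by
  refine ⟨fun h => veroneseChart_le ι j h, fun h => ?_⟩
  exact (pt_mem_veroneseChart_iff ι j Q h).mpr (sum_sq_eval_ratio_pos ι j Q h).ne'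

/-- **Every `L`-point lies in the Veronese open `V`** (`L` ordered): it lies in some chart `U_j`,
where `Σ_c t_{j,c}² ≥ 1`. In homogeneous coordinates: a point with coordinates in an ordered field
has `Σ x_c² ≠ 0`. [cite: AkbulutKing1992, Ch. II §4, Prop. 2.4.1] -/
theorem pt_mem_veroneseOpen (Q : AlgPoints X L) : Q.pt ∈ veroneseOpen ι := by
  have hcov : Q.pt ∈ (⊤ : X.left.Opens) := trivial
  rw [← (affineChartData ι).iSup_U, Opens.mem_iSup] at hcov
  obtain ⟨j, hj⟩ := hcov
  exact Opens.mem_iSup.mpr ⟨j, (pt_mem_veroneseChart_iff_mem_U ι j Q).mpr hj⟩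

/-- Over an ordered field the coordinate `y_{jj}` detects the chart `W_j`:
`y_{jj}(Q) ≠ 0 ↔ Q ∈ W_j`, for every `L`-point `Q` (computed in a chart `W_l ∋ Q`:
`y_{jj}(Q) = t_{l,j}(Q)²/g_l(Q)`, and `t_{l,j}(Q) ≠ 0 ↔ Q ∈ U_l ∩ U_j`). [folklore] -/
theorem eval_veroneseCoord_self_ne_zero_iff (j : Fin (n + 1)) (Q : AlgPoints X L) :
    Q.eval _ (pt_mem_veroneseOpen ι Q) (veroneseCoord ι j j) ≠ 0 ↔ Q.pt ∈ veroneseChart ι j := by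
  obtain ⟨l, hl⟩ := Opens.mem_iSup.mp (pt_mem_veroneseOpen ι Q)
  have hU : Q.pt ∈ (affineChartData ι).U l := veroneseChart_le ι l hl
  rw [eval_veroneseCoord ι j j l Q hl, pt_mem_veroneseChart_iff_mem_U,
    ← GeneratingSections.eval_ratio_ne_zero_iff ι l j Q hU]
  have hden := (sum_sq_eval_ratio_pos ι l Q hU).ne'
  rw [div_ne_zero_iff, ← pow_two]
  exact ⟨fun h => (pow_ne_zero_iff two_ne_zero).mp h.1, fun h => ⟨pow_ne_zero 2 h, hden⟩⟩

end Ordered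

/-! ### The Veronese coordinates form an algebraic coordinate system -/

section CoordSystem

variable {k : Type} [Field k] {X : SchemeOver k} {n : ℕ} (ι : X ⟶ projectiveSpace n k)

/-- **The constants of the chart lift are the scalars**: for `c ∈ k`, the image of `c` under
`k → (k[x]_{(x_j)})₀ → Γ(X, ι⁻¹D₊(x_j))` (constants of the `j`-th chart ring, pulled back along the
chart lift of `ι`) is the scalar `c` of the `k`-scheme `X` on `ι⁻¹D₊(x_j)`. [folklore] -/
theorem chartConst_eq (j : Fin (n + 1)) (c : k) :
    (preU ι.left j).topIso.hom (pull (chartLift ι.left j) (cst k (MvPolynomial.X j) c)) =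
      SchemeOver.scalarRingHom X ((affineChartData ι).U j) c := by
  refine (topIso_hom_pull_chartLift_cst (k := k) (ι := Fin (n + 1)) ι.left j c).trans ?_
  have key : ∀ g : X.left ⟶ Spec (.of k), g = X.hom →
      X.left.presheaf.map (homOfLE (le_top : (affineChartData ι).U j ≤ ⊤)).op (pull g c) =
        SchemeOver.scalarRingHom X ((affineChartData ι).U j) c := by
    rintro _ rfl
    rfl
  exact key _ (Over.w ι)

/-- `y_{jj}|_{W_j} = g_j⁻¹` is a unit of `Γ(X, W_j)`. [folklore] -/
theorem isUnit_veroneseLocal_self (j : Fin (n + 1)) : IsUnit (veroneseLocal ι j j j) := by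
  unfold veroneseLocal
  rw [(affineChartData ι).ratio_self j, mul_one, map_one, one_mul]
  exact Units.isUnit _

/-- `y_{jj}|_{W_j} · g_j|_{W_j} = 1`. [folklore] -/
theorem veroneseLocal_self_mul_den (j : Fin (n + 1)) :
    veroneseLocal ι j j j * rs (veroneseChart_le ι j) (veroneseDen ι j) = 1 := by
  rw [veroneseLocal_mul_den, (affineChartData ι).ratio_self j, mul_one, map_one]

/-- `t_{j,c}|_{W_j} = y_{jc}|_{W_j} · g_j|_{W_j}`. [folklore] -/
theorem rs_ratio_eq (j c : Fin (n + 1)) :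
    rs (veroneseChart_le ι j) ((affineChartData ι).ratio j c) =
      veroneseLocal ι j j c * rs (veroneseChart_le ι j) (veroneseDen ι j) := by
  rw [veroneseLocal_mul_den, (affineChartData ι).ratio_self j, one_mul]

/-- The charts `W_j` are affine when `ι` is a closed immersion (basic opens of the affine opens
`ι⁻¹D₊(x_j)`). [folklore] -/
theorem isAffineOpen_veroneseChart [IsClosedImmersion ι.left] (j : Fin (n + 1)) :
    IsAffineOpen (veroneseChart ι j) :=
  (isAffineOpen_affineChartData_U ι j).basicOpen _

/-- **Regular functions on `W_j` are polynomials in the `y_{ab}|_{W_j}` divided by a power of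
`y_{jj}|_{W_j}`** (`ι` a closed immersion): `s = a'/g_j^m` with `a' ∈ Γ(X, U_j)` a polynomial in
the `t_{j,c}` over `k` (Hartshorne II Prop. 7.2), and `t_{j,c} = y_{jc} g_j`, `g_j = y_{jj}⁻¹` on
`W_j`. [cite: Hartshorne1977, II Prop. 7.2] -/
theorem exists_mul_pow_eq_pullbackPoly [IsClosedImmersion ι.left] (j : Fin (n + 1))
    (s : Γ(X.left, veroneseChart ι j)) :
    ∃ (a : MvPolynomial (Fin ((n + 1) * (n + 1))) k) (M : ℕ),
      s * pullbackPoly (veroneseChart_le_veroneseOpen ι j) (veroneseCoords ι)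
          (MvPolynomial.X (vIdx j j)) ^ M =
        pullbackPoly (veroneseChart_le_veroneseOpen ι j) (veroneseCoords ι) a := by
  classical
  haveI : @IsClosedImmersion X.left (Proj (grading (Fin (n + 1)) k)) ι.left := ‹_›
  -- notation
  have hWU : veroneseChart ι j ≤ (affineChartData ι).U j := veroneseChart_le ι j
  have hWV : veroneseChart ι j ≤ veroneseOpen ι := veroneseChart_le_veroneseOpen ι j
  set σ : k →+* Γ(X.left, veroneseChart ι j) := SchemeOver.scalarRingHom X (veroneseChart ι j)
    with hσ
  set u : Γ(X.left, veroneseChart ι j) := rs hWU (veroneseDen ι j) with hu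
  set y : Fin ((n + 1) * (n + 1)) → Γ(X.left, veroneseChart ι j) :=
    fun m => rs hWV (veroneseCoords ι m) with hy
  have hyv : ∀ c, y (vIdx j c) = veroneseLocal ι j j c := fun c => by
    simp only [hy, veroneseCoords_vIdx, rs_veroneseCoord]
  have huy : u * y (vIdx j j) = 1 := by
    rw [hyv, mul_comm]
    exact veroneseLocal_self_mul_den ι j
  have hyc : ∀ c, rs hWU ((affineChartData ι).ratio j c) = y (vIdx j c) * u := fun c => by
    rw [hyv]
    exact rs_ratio_eq ι j c
  have hPX : ∀ b : MvPolynomial (Fin ((n + 1) * (n + 1))) k,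
      pullbackPoly hWV (veroneseCoords ι) b = eval₂ σ y b := fun b => rfl
  -- `s = a'/g_j^m` with `a' ∈ Γ(X, U_j)` (localization)
  have hU : IsAffineOpen ((affineChartData ι).U j) := isAffineOpen_affineChartData_U ι j
  haveI := hU.isLocalization_basicOpen (veroneseDen ι j)
  obtain ⟨⟨a', d⟩, hs⟩ := IsLocalization.surj (Submonoid.powers (veroneseDen ι j)) s
  obtain ⟨m, hm⟩ := (Submonoid.mem_powers_iff _ _).mp d.2
  dsimp only at hs
  rw [algebraMap_basicOpen_eq_rs, ← hm, map_pow] at hs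
  -- hs : s * u ^ m = rs _ a'
  -- `a'` is a polynomial in the ratios with coefficients in `k`
  obtain ⟨p, hp⟩ := exists_eq_eval₂_homRatio (k := k) (ι := Fin (n + 1)) ι.left j a'
  have hκ : (rs hWU).comp ((preU ι.left j).topIso.hom.hom.comp
      ((pull (chartLift ι.left j)).comp (cst k (MvPolynomial.X j)))) = σ :=
    RingHom.ext fun c => (congrArg (rs hWU) (chartConst_eq ι j c)).trans (rs_scalarRingHom hWU c)
  have hrs : rs hWU a' = eval₂ σ (fun c => y (vIdx j c) * u) p := by
    rw [hp]
    refine (MvPolynomial.eval₂_comp_left (rs hWU) _ _ p).trans ?_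
    congr 1
    funext c
    exact hyc c
  -- substitute `t_{j,c} = y_{jc} · u` : `a'|_W = A(y, u)`
  set A : MvPolynomial (Fin ((n + 1) * (n + 1) + 1)) k :=
    bind₁ (fun c : Fin (n + 1) => MvPolynomial.X (Fin.castSucc (vIdx j c)) *
      MvPolynomial.X (Fin.last ((n + 1) * (n + 1)))) p with hA
  have hAeval : eval₂ σ (Fin.snoc y u) A = eval₂ σ (fun c => y (vIdx j c) * u) p := by
    rw [hA, ← MvPolynomial.coe_eval₂Hom, MvPolynomial.eval₂Hom_bind₁]
    simp only [MvPolynomial.coe_eval₂Hom, MvPolynomial.eval₂_mul, MvPolynomial.eval₂_X,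
      Fin.snoc_castSucc, Fin.snoc_last]
  -- clear the inverted variable `u = y_{jj}⁻¹`
  obtain ⟨a, M, haM⟩ := exists_clear_denominator σ (vIdx j j) A
  have key := haM y u huy
  refine ⟨a * MvPolynomial.X (vIdx j j) ^ m, M, ?_⟩
  rw [pullbackPoly_X, hPX, MvPolynomial.eval₂_mul, MvPolynomial.eval₂_pow, MvPolynomial.eval₂_X,
    ← key, hAeval, ← hrs, ← hs]
  calc s * y (vIdx j j) ^ M = s * y (vIdx j j) ^ M * (u * y (vIdx j j)) ^ m := by
        rw [huy, one_pow, mul_one]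
    _ = s * u ^ m * y (vIdx j j) ^ M * y (vIdx j j) ^ m := by ring

variable {L : Type} [Field L] [LinearOrder L] [IsStrictOrderedRing L] [Algebra k L]

/-- **The Veronese coordinates are an algebraic coordinate system on the `L`-points of a closed
subscheme of `ℙⁿ_k`, for every ordered field `L ⊇ k`.** The `(n+1)²` regular functions
`y_{ab} = x_a x_b/Σ_c x_c²` on `V = X ∖ {Σ x_c² = 0}`: every `L`-point lies in `V`; around a point
of `U_j` the chart is `W_j = X ∩ D₊(x_j Σ_c x_c²)`, affine, cut out on `L`-points by `y_{jj} ≠ 0`,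
with `y_{jj}|_{W_j}` a unit and `Γ(X, W_j) = k[y_{ab}|_{W_j}][y_{jj}⁻¹]`-generated
(`exists_mul_pow_eq_pullbackPoly`). This is the scheme-theoretic content of "projective real
algebraic sets are affine" via the embedding `ℝPⁿ ↪ ℝ^{(n+1)²}`, `[x] ↦ (x_a x_b/|x|²)`.
[cite: AkbulutKing1992, Ch. II §4, Prop. 2.4.1 and Cor. 2.4.2] -/
theorem isAlgCoordSystem_veronese [IsClosedImmersion ι.left] :
    IsAlgCoordSystem L (veroneseOpen ι) (veroneseCoords ι) := by
  refine ⟨fun P => pt_mem_veroneseOpen ι P, fun P => ?_⟩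
  obtain ⟨j, hj⟩ := Opens.mem_iSup.mp (pt_mem_veroneseOpen ι P)
  refine ⟨veroneseChart ι j, veroneseChart_le_veroneseOpen ι j, MvPolynomial.X (vIdx j j),
    isAffineOpen_veroneseChart ι j, hj, fun Q => ?_, ?_, exists_mul_pow_eq_pullbackPoly ι j⟩
  · rw [MvPolynomial.aeval_X, coordMap_apply_of_mem (pt_mem_veroneseOpen ι Q),
      veroneseCoords_vIdx]
    exact (eval_veroneseCoord_self_ne_zero_iff ι j Q).symm
  · rw [pullbackPoly_X, veroneseCoords_vIdx, rs_veroneseCoord]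
    exact isUnit_veroneseLocal_self ι j

end CoordSystem

end Literature.AlgebraicGeometry.RealAlgebraic

end
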